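import Mathlib.Probability.Kernel.Composition.CompProd
import Mathlib.Probability.Kernel.Composition.MapComap
import Mathlib.Probability.Kernel.WithDensity
import Mathlib.Probability.Distributions.Exponential
import Literature.MathematicalPhysics.KineticTheory.FouriersLaw

/-!
# Jump perturbation of a measurable Markov semigroup, I: the Dyson–Phillips family
(brick for crux stmt-AtomisticToContinuum-11976 `VanishingNoiseTransfer.VanishingNoiseBound`, line
`fekete-usc-one-length`, stub S3 `stub_noisyPositiveConductance`; worker file, wave 2)

The residual content of S3 is semigroup theory of the flip-noisy chain `L + εS`, and the tree has no
Markov semigroup for it (only the flip-FREE transition semigroup `pinnedChainSemigroup` and the chain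
embedded at the flip times). The flip dynamics run the flip-free dynamics `P_t` between the events of a
rate-`Nε` Poisson clock and apply the uniform flip kernel `Q = flipKernel N` at the events; this is the
model-independent construction "Markov semigroup `P` + jumps by a Markov kernel `Q` at rate `r`", whose
transition kernels are given by the Dyson–Phillips (jump) expansion
`P^Q_t = ∑_n U_n(t)`, `U_n(t)` = the contribution of exactly `n` jumps in `[0, t]`.

This file is step I, the CONSTRUCTION of the family `U_n` for an abstract measurable space `X`, a
Markov kernel `K` from `ℝ × X` to `X` (to be read as the time-extended transition kernel
`K(t, x) = P_{t⁺}(x, ·)`), a Markov jump kernel `Q` on `X` and a rate `r > 0`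
(`exists_dysonPhillips`): finite kernels `U n` from `ℝ × X` to `X` with `U 0 (t, x) = e^{-rt} P_t(x, ·)`
and the last-jump recursion
`∫ f dU_{n+1}(t, x) = ∫ Exp_r(ds) 1_{s<t} ∫ U_n(t-s, x)(dy) ∫ Q(y, dy') ∫ P_s(y', dz) f(z)`
(`s` = the time elapsed since the last jump, exponential of rate `r` and independent of the past), built
from Mathlib's kernel combinators so that measurability is structural. Everything downstream (total
mass `e^{-rt}(rt)^n/n!`, the Markov property of `∑_n U_n(t)`, Chapman–Kolmogorov, the Dynkin identity
with generator `L + r(Q - 1)`) is proved from these two identities alone, in the sequel files.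
Also: `lintegral_expMeasure` (`∫ g dExp_r = ∫_{s>0} r e^{-rs} g(s) ds`). Registered sub-goal:
`helper_dysonPhillipsFamily` (the construction on the phase space of the chain).

No definitions (the family is delivered existentially). References: S. N. Ethier, T. G. Kurtz,
*Markov Processes* (1986), Ch. 4 §10 (perturbation by bounded jump generators) and Ch. 1 §7
(perturbation of semigroups); R. S. Phillips, *Perturbation theory for semi-groups of linear operators*,
Trans. AMS 74 (1953) (the Dyson–Phillips series).
-/

noncomputable section

namespace Summit.AtomisticToContinuum.FouriersLaw.Theorems.VanishingNoiseBound.JumpPerturbation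

open MeasureTheory ProbabilityTheory Filter Topology Set Function
open scoped NNReal ENNReal

variable {X : Type*} [MeasurableSpace X]

/-- Integration against Mathlib's exponential law `expMeasure r` (rate `r > 0`), Lebesgue form:
`∫⁻ g dExp_r = ∫⁻_{s > 0} r e^{-rs} g(s) ds`. [folklore] -/
theorem lintegral_expMeasure (r : ℝ) {g : ℝ → ℝ≥0∞} (hg : Measurable g) :
    ∫⁻ s, g s ∂(expMeasure r) = ∫⁻ s in Ioi 0, ENNReal.ofReal (r * Real.exp (-(r * s))) * g s := by
  have hm : Measurable (exponentialPDF r) := (measurable_exponentialPDFReal r).ennreal_ofReal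
  rw [show expMeasure r = volume.withDensity (exponentialPDF r) from rfl,
    lintegral_withDensity_eq_lintegral_mul _ hm hg]
  rw [← lintegral_indicator measurableSet_Ioi]
  have hpt : exponentialPDF r * g = (Ici (0:ℝ)).indicator
      (fun s => ENNReal.ofReal (r * Real.exp (-(r * s))) * g s) := by
    funext s
    simp only [Pi.mul_apply, indicator, mem_Ici, exponentialPDF_eq]
    split_ifs with hs
    · rfl
    · rw [ENNReal.ofReal_zero, zero_mul]
  rw [hpt]
  exact lintegral_congr_ae (indicator_ae_eq_of_ae_eq_set Ioi_ae_eq_Ici.symm)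

/-- The set `{(p, s) | s < p.1.1}` of admissible times-since-the-last-jump is measurable. [folklore] -/
theorem measurableSet_snd_lt_fst_fst :
    MeasurableSet {q : (ℝ × X) × ℝ | q.2 < q.1.1} :=
  measurableSet_lt measurable_snd (measurable_fst.comp measurable_fst)

/-- **The Dyson–Phillips (jump-expansion) family of a measurable Markov semigroup — construction.**
Let `K` be a Markov kernel from `ℝ × X` to `X` (the time-extended transition kernel
`K(t, x) = P_{t⁺}(x, ·)` of a measurable Markov semigroup), `Q` a Markov kernel on `X` (the jump law)
and `r > 0` (the jump rate). There is a sequence of finite kernels `U n` from `ℝ × X` to `X` —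
`U n (t, x)` = the sub-probability law at time `t`, on the event "exactly `n` jumps in `[0, t]`", of
the process started at `x` that follows `P` between the events of a rate-`r` Poisson clock and jumps
by `Q` at the events — characterised by: `U 0 (t, x) = e^{-rt} P_t(x, ·)` (`t ≥ 0`) and the
last-jump recursion
`∫ f dU_{n+1}(t, x) = ∫ Exp_r(ds) 1_{s < t} ∫ U_n(t - s, x)(dy) ∫ Q(y, dy') ∫ P_s(y', dz) f(z)`
(`s` = time since the last jump, an independent exponential). Built from Mathlib's kernel
combinators (`withDensity`, `const`, `piecewise`, `comap`, `⊗ₖ`, `snd`), so that all measurability is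
structural. [Ethier–Kurtz 1986, Ch. 4 §10 (perturbation by a bounded jump generator); folklore] -/
theorem exists_dysonPhillips (K : Kernel (ℝ × X) X) [IsMarkovKernel K] (Q : Kernel X X)
    [IsMarkovKernel Q] {r : ℝ} (hr : 0 < r) :
    ∃ U : ℕ → Kernel (ℝ × X) X, (∀ n, IsFiniteKernel (U n)) ∧
      (∀ p : ℝ × X, 0 ≤ p.1 → U 0 p = ENNReal.ofReal (Real.exp (-(r * p.1))) • K p) ∧
      (∀ (n : ℕ) (p : ℝ × X) (f : X → ℝ≥0∞), Measurable f →
        ∫⁻ z, f z ∂(U (n + 1) p) =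
          ∫⁻ s, (Iio p.1).indicator (fun s =>
            ∫⁻ y, ∫⁻ y', ∫⁻ z, f z ∂(K (s, y')) ∂(Q y) ∂(U n (p.1 - s, p.2))) s ∂(expMeasure r)) := by
  haveI := isProbabilityMeasure_expMeasure hr
  -- the zeroth term `e^{-r t⁺} P_t`
  let d : ℝ × X → X → ℝ≥0∞ := fun p _ => ENNReal.ofReal (Real.exp (-(r * max p.1 0)))
  have hd : Measurable (uncurry d) :=
    (ENNReal.measurable_ofReal.comp (Real.measurable_exp.comp
      ((measurable_const.mul (measurable_fst.max measurable_const)).neg))).comp measurable_fst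
  have hd1 : ∀ p x, d p x ≤ 1 := fun p x => by
    change ENNReal.ofReal _ ≤ 1
    rw [ENNReal.ofReal_le_one, Real.exp_le_one_iff, neg_nonpos]
    exact mul_nonneg hr.le (le_max_right _ _)
  let U0 : Kernel (ℝ × X) X := Kernel.withDensity K d
  have hU0fin : IsFiniteKernel U0 := Kernel.isFiniteKernel_withDensity_of_bounded K ENNReal.one_ne_top hd1
  -- the recursion step
  let τ : Kernel (ℝ × X) ℝ := Kernel.const (ℝ × X) (expMeasure r)
  let g₁ : (ℝ × X) × ℝ → ℝ × X := fun q => (q.1.1 - q.2, q.1.2)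
  have hg₁ : Measurable g₁ := by fun_prop
  let g₂ : (ℝ × X) × (ℝ × X) → X := fun q => q.2.2
  have hg₂ : Measurable g₂ := by fun_prop
  let g₃ : (ℝ × X) × ((ℝ × X) × X) → ℝ × X := fun q => (q.2.1.1, q.2.2)
  have hg₃ : Measurable g₃ := by fun_prop
  let step : {W : Kernel (ℝ × X) X // IsFiniteKernel W} → {W : Kernel (ℝ × X) X // IsFiniteKernel W} :=
    fun W =>
      haveI := W.2
      ⟨Kernel.snd (((τ ⊗ₖ Kernel.piecewise measurableSet_snd_lt_fst_fst (W.1.comap g₁ hg₁) 0) ⊗ₖ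
          Q.comap g₂ hg₂) ⊗ₖ K.comap g₃ hg₃), inferInstance⟩
  let Urec : ℕ → {W : Kernel (ℝ × X) X // IsFiniteKernel W} :=
    fun n => Nat.rec ⟨U0, hU0fin⟩ (fun _ W => step W) n
  refine ⟨fun n => (Urec n).1, fun n => (Urec n).2, fun p hp => ?_, fun n p f hf => ?_⟩
  · -- `U 0 (t, x) = e^{-rt} P_t(x, ·)` for `t ≥ 0`
    change Kernel.withDensity K d p = _
    rw [Kernel.withDensity_apply K hd, show d p = fun _ => ENNReal.ofReal (Real.exp (-(r * p.1))) from
      funext fun _ => by simp [d, max_eq_left hp], withDensity_const]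
  · -- the last-jump recursion
    haveI := (Urec n).2
    set W := (Urec n).1 with hW
    change ∫⁻ z, f z ∂((step (Urec n)).1 p) = _
    simp only [step]
    rw [Kernel.lintegral_snd _ _ hf, Kernel.lintegral_compProd _ _ _
      (show Measurable (fun bc : ((ℝ × X) × X) × X => f bc.2) from hf.comp measurable_snd)]
    have h3 : ∀ u : (ℝ × X) × X, ∫⁻ z, f z ∂((K.comap g₃ hg₃) (p, u)) = ∫⁻ z, f z ∂(K (u.1.1, u.2)) :=
      fun u => by rw [Kernel.comap_apply]
    simp_rw [h3]
    have hm3 : Measurable fun u : (ℝ × X) × X => ∫⁻ z, f z ∂(K (u.1.1, u.2)) := by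
      have : Measurable fun u : (ℝ × X) × X => ∫⁻ z, f z ∂((K.comap
          (fun u : (ℝ × X) × X => (u.1.1, u.2)) (by fun_prop)) u) := hf.lintegral_kernel
      simpa only [Kernel.comap_apply] using this
    rw [Kernel.lintegral_compProd _ _ _ hm3]
    have h2 : ∀ v : ℝ × X, ∫⁻ y', ∫⁻ z, f z ∂(K (v.1, y')) ∂((Q.comap g₂ hg₂) (p, v)) =
        ∫⁻ y', ∫⁻ z, f z ∂(K (v.1, y')) ∂(Q v.2) := fun v => by rw [Kernel.comap_apply]
    simp_rw [h2]
    have hm2 : Measurable fun v : ℝ × X => ∫⁻ y', ∫⁻ z, f z ∂(K (v.1, y')) ∂(Q v.2) := by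
      have hi : Measurable fun w : (ℝ × X) × X => ∫⁻ z, f z ∂(K (w.1.1, w.2)) := by
        have : Measurable fun w : (ℝ × X) × X => ∫⁻ z, f z ∂((K.comap
            (fun w : (ℝ × X) × X => (w.1.1, w.2)) (by fun_prop)) w) := hf.lintegral_kernel
        simpa only [Kernel.comap_apply] using this
      have : Measurable fun v : ℝ × X => ∫⁻ y', (fun w : (ℝ × X) × X => ∫⁻ z, f z ∂(K (w.1.1, w.2)))
          (v, y') ∂((Q.comap (fun v : ℝ × X => v.2) measurable_snd) v) :=
        hi.lintegral_kernel_prod_right'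
      simpa only [Kernel.comap_apply] using this
    rw [Kernel.lintegral_compProd _ _ _ hm2]
    simp only [τ, Kernel.const_apply]
    refine lintegral_congr fun s => ?_
    rw [Kernel.lintegral_piecewise]
    simp only [mem_setOf_eq, indicator, mem_Iio]
    split_ifs with hs
    · rw [Kernel.comap_apply]
    · simp

/-- **Registered sub-goal `helper_dysonPhillipsFamily`** of stmt-AtomisticToContinuum-11976 (brick for stub S3
`stub_noisyPositiveConductance`): `exists_dysonPhillips` on the phase space of the `N`-particle chain
(where `K` will be the time-extended kernel of `pinnedChainSemigroup` and `Q = flipKernel N`, `r = Nε`),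
fully quantified and notation-free. [folklore] -/
theorem helper_dysonPhillipsFamily : ∀ (N : ℕ) (K : ProbabilityTheory.Kernel (ℝ × Literature.MathematicalPhysics.KineticTheory.HeatConduction.PhaseSpace N) (Literature.MathematicalPhysics.KineticTheory.HeatConduction.PhaseSpace N)) [ProbabilityTheory.IsMarkovKernel K] (Q : ProbabilityTheory.Kernel (Literature.MathematicalPhysics.KineticTheory.HeatConduction.PhaseSpace N) (Literature.MathematicalPhysics.KineticTheory.HeatConduction.PhaseSpace N)) [ProbabilityTheory.IsMarkovKernel Q] (r : ℝ), 0 < r → ∃ U : ℕ → ProbabilityTheory.Kernel (ℝ × Literature.MathematicalPhysics.KineticTheory.HeatConduction.PhaseSpace N) (Literature.MathematicalPhysics.KineticTheory.HeatConduction.PhaseSpace N), (∀ n, ProbabilityTheory.IsFiniteKernel (U n)) ∧ (∀ p : ℝ × Literature.MathematicalPhysics.KineticTheory.HeatConduction.PhaseSpace N, 0 ≤ p.1 → U 0 p = ENNReal.ofReal (Real.exp (-(r * p.1))) • K p) ∧ (∀ (n : ℕ) (p : ℝ × Literature.MathematicalPhysics.KineticTheory.HeatConduction.PhaseSpace N)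 (f : Literature.MathematicalPhysics.KineticTheory.HeatConduction.PhaseSpace N → ENNReal), Measurable f → MeasureTheory.lintegral (U (n + 1) p) (fun z => f z) = MeasureTheory.lintegral (ProbabilityTheory.expMeasure r) (fun s => (Set.Iio p.1).indicator (fun s => MeasureTheory.lintegral (U n (p.1 - s, p.2)) (fun y => MeasureTheory.lintegral (Q y) (fun y' => MeasureTheory.lintegral (K (s, y')) (fun z => f z)))) s)) :=
  fun _ K _ Q _ _ hr => exists_dysonPhillips K Q hr

end Summit.AtomisticToContinuum.FouriersLaw.Theorems.VanishingNoiseBound.JumpPerturbation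

end
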